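import Mathlib
import Summits.Schanuel.Schanuel.Statement
import Literature.NumberTheory.Transcendental.RoyCriterion
import Literature.NumberTheory.Transcendental.RoyCriterionProofs
import Literature.NumberTheory.Transcendental.TijdemanZeroEstimateProofs
import Literature.NumberTheory.Transcendental.ExpPolynomialIndep
import Summits.Schanuel.Schanuel.Theorems.SoloBlindPadeNormalForm
import HarnessLib

/-!
# Hermite perfectness: the exact maximal contact of `P(w, e^w)` with zero, and the Taylor matrix

`Summits/Schanuel/Schanuel/Theorems/SoloBlindHermitePerfect.lean` (soloist `solo-Schanuel-blind`,
session 11).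

`SoloBlindPadeNormalForm.lean` put Roy's hypothesis (Acta Arith. 97 (2001), Conjecture 2) in
PADÉ NORMAL FORM: a sequence of non-zero `P_N ∈ ℤ[X₀, X₁]`, `deg ≤ (N^{t₀}, N^{t₁})`,
`H(P_N) ≤ e^N`, whose integer Taylor functionals `taylorInt n P_N = (DⁿP_N)(0,1) =
(d/dw)ⁿ P_N(w, e^w)|_{w=0}` vanish for all `n ≤ N^u`, i.e. integer Hermite–Padé-type forms
`Σ_b A_b(w) e^{bw} = O(w^{N^u})` for `(1, e^w, …, e^{T₁ w})`.  This file pins the other end of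
the scale in the kernel: the MAXIMAL contact.  For a non-zero `P` of bidegree `≤ (T₀, T₁)` the
function `P(w, e^w)` vanishes at ANY point `z₀ ∈ ℂ` to order at most `(T₀+1)(T₁+1) - 1`
(Hermite 1873; "the exponential system is perfect", Mahler 1931; Chudnovsky, Def. 1.1), and
order exactly `(T₀+1)(T₁+1) - 1` at `w = 0` is attained.  Equivalently, the square integer
TAYLOR MATRIX `(taylorInt n (X₀^a X₁^b))_{n < (T₀+1)(T₁+1), a ≤ T₀, b ≤ T₁}` of the tree
(`taylorMatrix`, used there only through Siegel's lemma) is NON-SINGULAR.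

Consequence for the wall (`wall.md` §4 R-A6): with `T₀ = ⌊N^{t₀}⌋`, `T₁ = ⌊N^{t₁}⌋` the contact
of ANY non-zero form is `< (T₀+1)(T₁+1) ≍ N^{t₀+t₁}`, so Roy's window
`u < (1+t₀+t₁)/2 < t₀+t₁` (the tree's `SoloBlindRoyWindow`) asks for forms of GENUINELY
SUB-MAXIMAL order `N^u`, strictly inside the Padé table between the trivial order and the
Hermite corner `N^{t₀+t₁}`, where the explicit (maximal-order) Hermite forms have height
`exp(≍ N^{t₀+t₁} log N) ≫ e^N`.

## Contents (no definitions)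

* `iteratedDeriv_qexp_pstep` — the operators `D - a` of `TijdemanZeroEstimateProofs.lean`
  act on jets: `(qexp (pstep σ a Q))^{(n)}(z) = (qexp Q)^{(n+1)}(z) - a (qexp Q)^{(n)}(z)`.
* `qexp_eq_zero_of_iteratedDeriv_eq_zero`, `exists_iteratedDeriv_qexp_ne_zero` — HERMITE'S
  BOUND for `F = Σ_l Q_l(z) e^{σ_l z}` with pairwise distinct `σ_l ∈ ℂ`: if `F^{(n)}(z₀) = 0` for
  all `n < Σ_{Q_l ≠ 0} (deg Q_l + 1)` then all `Q_l = 0` (induction on the size with `D - σ_{l₀}`,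
  exactly as in `ExpPolynomialIndep.lean`, whose hypothesis `F ≡ 0` is weakened here to the
  vanishing of one jet).
* `expEval_polyOfCoeffs_eq_qexp`, `eq_zero_of_slices_eq_zero`, `qsize_slices_le` — the
  dictionary `P(w, e^w) = Σ_{b ≤ T₁} (Σ_{a ≤ T₀} t(a,b) w^a) e^{bw}`.
* `exists_iteratedDeriv_expEval_ne_zero`, `exists_taylorInt_ne_zero`, `contact_lt` — for
  `P ≠ 0` of bidegree `≤ (T₀, T₁)`: some `n < (T₀+1)(T₁+1)` has `(d/dw)ⁿP(w,e^w)|_{z₀} ≠ 0`, in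
  particular `taylorInt n P ≠ 0`; a form with `taylorInt n P = 0` for all `n ≤ K` has
  `K + 1 < (T₀+1)(T₁+1)`.
* `eq_zero_of_taylorMatrix_mulVec_eq_zero`, `taylorMatrix_mulVec_injective`,
  `det_taylorMatrix_ne_zero` — the square Taylor matrix is non-singular.
* `exists_maximal_contact` — a non-zero `P` of bidegree `≤ (T₀, T₁)` with `taylorInt n P = 0`
  for all `n < (T₀+1)(T₁+1) - 1` exists (a square integer matrix with a zero row has a kernel
  vector); with `exists_taylorInt_ne_zero` this is the perfectness of `(1, e^w, …, e^{T₁w})` at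
  equal weights `T₀`: `hermite_perfect`.

References: C. Hermite, *Sur la fonction exponentielle*, C. R. Acad. Sci. Paris 77 (1873);
K. Mahler, *Zur Approximation der Exponentialfunktion und des Logarithmus. I*, J. reine angew.
Math. 166 (1931) 118–136; G. V. Chudnovsky, *Number theoretic applications of polynomials with
rational coefficients defined by extremality conditions*, in: Arithmetic and Geometry I
(Artin, Tate eds., 1983) = Classical and Quantum Models and Arithmetic Problems (2018) p. 147,
Definition 1.1 (perfect systems); A. Baker, *Transcendental Number Theory* (1975) Ch. 12 §2;
D. Roy, Acta Arith. 97 (2001) 183–194.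
-/

noncomputable section

open scoped Classical
open Complex Polynomial Finset

namespace Summit.Schanuel.Schanuel.Theorems

open Literature.NumberTheory.Transcendental Literature.NumberTheory.Transcendental.Tijdeman

/-! ### Hermite's multiplicity bound for `Σ Q_l(z) e^{σ_l z}` at one point -/

section Hermite

variable {L : ℕ}

/-- The operator `D - a` acts on jets: `(qexp (pstep σ a Q) σ)^{(n)}(z) =
(qexp Q σ)^{(n+1)}(z) - a · (qexp Q σ)^{(n)}(z)`. [folklore] -/
theorem iteratedDeriv_qexp_pstep (Q : Fin L → ℂ[X]) (σ : Fin L → ℂ) (a z : ℂ) (n : ℕ) :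
    iteratedDeriv n (qexp (pstep σ a Q) σ) z =
      iteratedDeriv (n + 1) (qexp Q σ) z - a * iteratedDeriv n (qexp Q σ) z := by
  have hderiv : deriv (qexp Q σ) = qexp (pstep σ 0 Q) σ := by
    funext w
    have h := deriv_qexp_sub Q σ 0 w
    rw [zero_mul, sub_zero] at h
    exact h
  have hfun : qexp (pstep σ a Q) σ = deriv (qexp Q σ) - fun w => a * qexp Q σ w := by
    funext w
    rw [Pi.sub_apply, deriv_qexp_sub]
  have h1 : ContDiffAt ℂ n (deriv (qexp Q σ)) z := by
    rw [hderiv]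
    exact (differentiable_qexp _ σ).contDiff.contDiffAt
  have h2 : ContDiffAt ℂ n (fun w => a * qexp Q σ w) z :=
    contDiffAt_const.mul (differentiable_qexp Q σ).contDiff.contDiffAt
  rw [hfun, iteratedDeriv_sub h1 h2, iteratedDeriv_const_mul_field, iteratedDeriv_succ']

/-- **Hermite's bound (perfectness of the exponential system).** If the frequencies `σ_l` are
pairwise distinct and the jet of `F(z) = Σ_l Q_l(z) e^{σ_l z}` at a point `z₀` vanishes to order
`Σ_{Q_l ≠ 0} (deg Q_l + 1)`, then every `Q_l = 0`: a non-trivial exponential polynomial vanishes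
at any point to order at most `Σ (deg Q_l + 1) - 1`.  Induction on the size with the operator
`D - σ_{l₀}`, which lowers it by one and shifts the vanishing jet. [folklore] -/
theorem qexp_eq_zero_of_iteratedDeriv_eq_zero {σ : Fin L → ℂ} (hσ : Function.Injective σ)
    (z₀ : ℂ) :
    ∀ (N : ℕ) (Q : Fin L → ℂ[X]), (∑ l, if Q l = 0 then 0 else (Q l).natDegree + 1) ≤ N →
      (∀ n < ∑ l, (if Q l = 0 then 0 else (Q l).natDegree + 1),
        iteratedDeriv n (qexp Q σ) z₀ = 0) → Q = 0 := by
  intro N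
  induction N with
  | zero =>
    intro Q hN _
    exact (qsize_eq_zero_iff Q).mp (Nat.le_zero.mp hN)
  | succ N ih =>
    intro Q hN hQ
    by_contra hQ0
    obtain ⟨l₀, hl₀⟩ := Function.ne_iff.mp hQ0
    replace hl₀ : Q l₀ ≠ 0 := hl₀
    set Q' : Fin L → ℂ[X] := pstep σ (σ l₀) Q with hQ'
    -- the size drops by at least one
    have hsize : (∑ l, if Q' l = 0 then 0 else (Q' l).natDegree + 1) <
        ∑ l, if Q l = 0 then 0 else (Q l).natDegree + 1 := by
      refine Finset.sum_lt_sum (fun l _ => ?_) ⟨l₀, Finset.mem_univ _, ?_⟩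
      · by_cases hl : Q l = 0
        · have : Q' l = 0 := by simp [hQ', pstep, hl]
          rw [if_pos hl, if_pos this]
        · rw [if_neg hl]
          split_ifs
          · exact Nat.zero_le _
          · exact Nat.succ_le_succ (natDegree_pstep_le σ _ Q l)
      · rw [if_neg hl₀, hQ', pstep_self]
        split_ifs with hd
        · exact Nat.succ_pos _
        · refine Nat.succ_lt_succ (natDegree_derivative_lt fun h0 => hd ?_)
          exact derivative_of_natDegree_zero h0
    -- the jet of `Q'` vanishes to the smaller order
    have hQ'van : ∀ n < ∑ l, (if Q' l = 0 then 0 else (Q' l).natDegree + 1),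
        iteratedDeriv n (qexp Q' σ) z₀ = 0 := by
      intro n hn
      rw [hQ', iteratedDeriv_qexp_pstep, hQ (n + 1) (by omega), hQ n (by omega), mul_zero,
        sub_zero]
    have hQ'0 : Q' = 0 := ih Q' (by omega) hQ'van
    -- consequences: `Q_l = 0` for `l ≠ l₀`, `Q_{l₀}` constant
    have hother : ∀ l, l ≠ l₀ → Q l = 0 := by
      intro l hl
      have h := congr_fun hQ'0 l
      simp only [hQ', pstep, Pi.zero_apply] at h
      exact eq_zero_of_derivative_add_C_mul_eq_zero (sub_ne_zero.mpr fun e => hl (hσ e)) h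
    have hder : derivative (Q l₀) = 0 := by
      have h := congr_fun hQ'0 l₀
      rwa [hQ', pstep_self] at h
    have hconst : Q l₀ = C ((Q l₀).coeff 0) :=
      eq_C_of_natDegree_eq_zero (Polynomial.derivative_eq_zero.mp hder)
    -- evaluate the `0`-jet at `z₀`
    have hpos : 0 < ∑ l, (if Q l = 0 then 0 else (Q l).natDegree + 1) := by omega
    have h0 := hQ 0 hpos
    rw [iteratedDeriv_zero] at h0
    simp only [qexp] at h0
    rw [Finset.sum_eq_single l₀ (fun l _ hl => by rw [hother l hl, eval_zero, zero_mul])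
      (fun h => absurd (Finset.mem_univ _) h)] at h0
    rcases mul_eq_zero.mp h0 with h0 | h0
    · apply hl₀
      rw [hconst] at h0 ⊢
      rw [eval_C] at h0
      rw [h0, C_0]
    · exact Complex.exp_ne_zero _ h0

/-- Hermite's bound, existential form: for `Q ≠ 0` and pairwise distinct frequencies some
derivative of order `< Σ_{Q_l ≠ 0} (deg Q_l + 1)` of `Σ Q_l(z) e^{σ_l z}` is non-zero at `z₀`.
[folklore] -/
theorem exists_iteratedDeriv_qexp_ne_zero {σ : Fin L → ℂ} (hσ : Function.Injective σ)
    {Q : Fin L → ℂ[X]} (hQ : Q ≠ 0) (z₀ : ℂ) :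
    ∃ n < ∑ l, (if Q l = 0 then 0 else (Q l).natDegree + 1),
      iteratedDeriv n (qexp Q σ) z₀ ≠ 0 := by
  by_contra h
  push Not at h
  exact hQ (qexp_eq_zero_of_iteratedDeriv_eq_zero hσ z₀ _ Q le_rfl h)

end Hermite

/-! ### The dictionary `P(w, e^w) = Σ_b (Σ_a t(a,b) w^a) e^{bw}` -/

/-- `polyOfCoeffs t (w, e^w)` is the exponential polynomial with coefficient polynomials the
`X₁`-slices `Σ_a t(a,b) X^a` and frequencies `b = 0, 1, …, T₁`. [folklore] -/
theorem expEval_polyOfCoeffs_eq_qexp {T₀ T₁ : ℕ} (t : Fin (T₀ + 1) × Fin (T₁ + 1) → ℤ) :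
    expEval (polyOfCoeffs t) =
      qexp (fun b : Fin (T₁ + 1) => ∑ a : Fin (T₀ + 1), C ((t (a, b) : ℂ)) * X ^ (a : ℕ))
        (fun b => ((b : ℕ) : ℂ)) := by
  funext w
  rw [expEval_polyOfCoeffs, Fintype.sum_prod_type, Finset.sum_comm]
  simp only [qexp, eval_finsetSum, eval_mul, eval_C, eval_pow, eval_X, Finset.sum_mul,
    Complex.exp_nat_mul]
  refine Finset.sum_congr rfl fun b _ => Finset.sum_congr rfl fun a _ => ?_
  ring

/-- The slices determine the coefficient vector: all slices zero ⇒ `t = 0`. [folklore] -/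
theorem eq_zero_of_slices_eq_zero {T₀ T₁ : ℕ} (t : Fin (T₀ + 1) × Fin (T₁ + 1) → ℤ)
    (h : (fun b : Fin (T₁ + 1) => ∑ a : Fin (T₀ + 1), C ((t (a, b) : ℂ)) * X ^ (a : ℕ)) = 0) :
    t = 0 := by
  funext ab
  obtain ⟨a, b⟩ := ab
  rw [Pi.zero_apply]
  have hb := congr_fun h b
  simp only [Pi.zero_apply] at hb
  have hc := congr_arg (fun p : ℂ[X] => p.coeff (a : ℕ)) hb
  simp only [finsetSum_coeff, coeff_C_mul, coeff_X_pow, coeff_zero] at hc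
  rw [Finset.sum_eq_single a (fun x _ hx => by rw [if_neg (fun e => hx (Fin.ext e).symm),
    mul_zero]) (fun ha => absurd (Finset.mem_univ a) ha), if_pos rfl, mul_one] at hc
  exact_mod_cast hc

/-- The size `Σ_b (deg (slice b) + 1)` of the slices is at most `(T₀+1)(T₁+1)`. [folklore] -/
theorem qsize_slices_le {T₀ T₁ : ℕ} (t : Fin (T₀ + 1) × Fin (T₁ + 1) → ℤ) :
    (∑ b : Fin (T₁ + 1),
        if (fun b : Fin (T₁ + 1) => ∑ a : Fin (T₀ + 1), C ((t (a, b) : ℂ)) * X ^ (a : ℕ)) b = 0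
        then 0 else
          ((fun b : Fin (T₁ + 1) => ∑ a : Fin (T₀ + 1), C ((t (a, b) : ℂ)) * X ^ (a : ℕ)) b).natDegree
            + 1) ≤ (T₀ + 1) * (T₁ + 1) := by
  calc _ ≤ ∑ _b : Fin (T₁ + 1), (T₀ + 1) := Finset.sum_le_sum fun b _ => ?_
    _ = (T₀ + 1) * (T₁ + 1) := by simp [mul_comm]
  split_ifs
  · exact Nat.zero_le _
  · refine Nat.succ_le_succ (natDegree_sum_le_of_forall_le _ _ fun a _ => ?_)
    exact (natDegree_C_mul_X_pow_le _ _).trans (Nat.lt_succ_iff.mp a.isLt)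

/-! ### The maximal contact of `P(w, e^w)`: `< (T₀+1)(T₁+1)` at every point -/

/-- **Hermite's bound for `P(w, e^w)`.** For a non-zero `P ∈ ℤ[X₀, X₁]` with `deg_{X₀} P ≤ T₀`,
`deg_{X₁} P ≤ T₁` and any `z₀ ∈ ℂ`, some derivative of `w ↦ P(w, e^w)` of order
`< (T₀+1)(T₁+1)` does not vanish at `z₀`. [folklore] -/
theorem exists_iteratedDeriv_expEval_ne_zero {T₀ T₁ : ℕ} (P : MvPolynomial (Fin 2) ℤ)
    (hP : P ≠ 0) (h0 : P.degreeOf 0 ≤ T₀) (h1 : P.degreeOf 1 ≤ T₁) (z₀ : ℂ) :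
    ∃ n < (T₀ + 1) * (T₁ + 1), iteratedDeriv n (expEval P) z₀ ≠ 0 := by
  set t : Fin (T₀ + 1) × Fin (T₁ + 1) → ℤ := fun ab => P.coeff (boxExp ab) with ht
  have hPt : polyOfCoeffs t = P := polyOfCoeffs_coeff_boxExp P h0 h1
  have hσ : Function.Injective (fun b : Fin (T₁ + 1) => ((b : ℕ) : ℂ)) := by
    intro b b' h
    simp only at h
    exact Fin.ext (by exact_mod_cast h)
  have hQ0 : (fun b : Fin (T₁ + 1) => ∑ a : Fin (T₀ + 1), C ((t (a, b) : ℂ)) * X ^ (a : ℕ))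
      ≠ 0 := by
    intro hQ
    apply hP
    rw [← hPt, eq_zero_of_slices_eq_zero t hQ]
    simp [polyOfCoeffs]
  obtain ⟨n, hn, hne⟩ := exists_iteratedDeriv_qexp_ne_zero hσ hQ0 z₀
  refine ⟨n, lt_of_lt_of_le hn (qsize_slices_le t), ?_⟩
  rwa [← hPt, expEval_polyOfCoeffs_eq_qexp]

/-- **The integer Taylor functionals detect every non-zero form below the Hermite corner.**
For `P ≠ 0` with `deg ≤ (T₀, T₁)` some `n < (T₀+1)(T₁+1)` has `taylorInt n P ≠ 0`: the contact
of `P(w, e^w)` with zero at `w = 0` is at most `(T₀+1)(T₁+1) - 1`. [folklore] -/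
theorem exists_taylorInt_ne_zero {T₀ T₁ : ℕ} (P : MvPolynomial (Fin 2) ℤ) (hP : P ≠ 0)
    (h0 : P.degreeOf 0 ≤ T₀) (h1 : P.degreeOf 1 ≤ T₁) :
    ∃ n < (T₀ + 1) * (T₁ + 1), taylorInt n P ≠ 0 := by
  obtain ⟨n, hn, hne⟩ := exists_iteratedDeriv_expEval_ne_zero P hP h0 h1 0
  refine ⟨n, hn, fun h => hne ?_⟩
  rw [← taylorInt_cast, h, Int.cast_zero]

/-- Exponent bookkeeping form: if a non-zero `P` with `deg ≤ (T₀, T₁)` has `taylorInt n P = 0`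
for all `n ≤ K` (a Padé-type form of order `> K`), then `K + 1 < (T₀+1)(T₁+1)`.  With
`T₀ = ⌊N^{t₀}⌋`, `T₁ = ⌊N^{t₁}⌋`, `K = ⌊N^u⌋` this is the necessity of `u ≤ t₀ + t₁` for the Padé
normal form of Roy's hypothesis; Roy's window has `u < t₀ + t₁` (tree: `SoloBlindRoyWindow`).
[this work; folklore] -/
theorem contact_lt {T₀ T₁ K : ℕ} (P : MvPolynomial (Fin 2) ℤ) (hP : P ≠ 0)
    (h0 : P.degreeOf 0 ≤ T₀) (h1 : P.degreeOf 1 ≤ T₁) (hvan : ∀ n ≤ K, taylorInt n P = 0) :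
    K + 1 < (T₀ + 1) * (T₁ + 1) := by
  obtain ⟨n, hn, hne⟩ := exists_taylorInt_ne_zero P hP h0 h1
  have hKn : K < n := by
    by_contra hle
    exact hne (hvan n (not_lt.mp hle))
  omega

/-! ### The square Taylor matrix is non-singular -/

/-- A coefficient vector killed by the `(T₀+1)(T₁+1)` Taylor equations is zero. [folklore] -/
theorem eq_zero_of_taylorMatrix_mulVec_eq_zero {T₀ T₁ : ℕ}
    {t : Fin (T₀ + 1) × Fin (T₁ + 1) → ℤ}
    (h : Matrix.mulVec (taylorMatrix ((T₀ + 1) * (T₁ + 1)) T₀ T₁) t = 0) : t = 0 := by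
  by_contra ht
  obtain ⟨n, hn, hne⟩ := exists_taylorInt_ne_zero (polyOfCoeffs t) (polyOfCoeffs_ne_zero ht)
    (degreeOf_polyOfCoeffs_fst t) (degreeOf_polyOfCoeffs_snd t)
  apply hne
  have := congr_fun h ⟨n, hn⟩
  rwa [taylorMatrix_mulVec] at this

/-- **Non-singularity of the Taylor matrix**: `t ↦ (taylorInt n (polyOfCoeffs t))_{n < (T₀+1)(T₁+1)}`
is injective on `ℤ^{(T₀+1)(T₁+1)}`. [folklore] -/
theorem taylorMatrix_mulVec_injective (T₀ T₁ : ℕ) :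
    Function.Injective fun t : Fin (T₀ + 1) × Fin (T₁ + 1) → ℤ =>
      Matrix.mulVec (taylorMatrix ((T₀ + 1) * (T₁ + 1)) T₀ T₁) t := by
  intro t t' h
  have h' : Matrix.mulVec (taylorMatrix ((T₀ + 1) * (T₁ + 1)) T₀ T₁) (t - t') = 0 := by
    rw [Matrix.mulVec_sub]
    exact sub_eq_zero.mpr h
  exact sub_eq_zero.mp (eq_zero_of_taylorMatrix_mulVec_eq_zero h')

/-- **The determinant of the square Taylor matrix is non-zero** (rows re-indexed by the box via
`finProdFinEquiv`). [folklore] -/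
theorem det_taylorMatrix_ne_zero (T₀ T₁ : ℕ) :
    ((taylorMatrix ((T₀ + 1) * (T₁ + 1)) T₀ T₁).submatrix
        (finProdFinEquiv : Fin (T₀ + 1) × Fin (T₁ + 1) ≃ Fin ((T₀ + 1) * (T₁ + 1))) id).det
      ≠ 0 := by
  intro hdet
  obtain ⟨v, hv, hAv⟩ := Matrix.exists_mulVec_eq_zero_iff.mpr hdet
  refine hv (eq_zero_of_taylorMatrix_mulVec_eq_zero (T₀ := T₀) (T₁ := T₁) ?_)
  funext n
  have h := congr_fun hAv (finProdFinEquiv.symm n)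
  rw [Pi.zero_apply] at h ⊢
  rw [← h]
  simp only [Matrix.mulVec, dotProduct, Matrix.submatrix_apply, id_eq, Equiv.apply_symm_apply]

/-! ### The maximal contact `(T₀+1)(T₁+1) - 1` is attained -/

/-- **Existence of maximal-order forms.** For every `T₀, T₁` there is a non-zero
`P ∈ ℤ[X₀, X₁]` with `deg ≤ (T₀, T₁)` and `taylorInt n P = 0` for all `n < (T₀+1)(T₁+1) - 1`
(`(T₀+1)(T₁+1) - 1` homogeneous integer equations in `(T₀+1)(T₁+1)` unknowns: the square matrix
completed by a zero row has determinant `0`, hence an integer kernel vector). [folklore] -/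
theorem exists_maximal_contact (T₀ T₁ : ℕ) :
    ∃ P : MvPolynomial (Fin 2) ℤ, P ≠ 0 ∧ P.degreeOf 0 ≤ T₀ ∧ P.degreeOf 1 ≤ T₁ ∧
      ∀ n, n + 1 < (T₀ + 1) * (T₁ + 1) → taylorInt n P = 0 := by
  have hMpos : 0 < (T₀ + 1) * (T₁ + 1) := Nat.mul_pos (Nat.succ_pos _) (Nat.succ_pos _)
  let e : Fin (T₀ + 1) × Fin (T₁ + 1) ≃ Fin ((T₀ + 1) * (T₁ + 1)) := finProdFinEquiv
  let B : Matrix (Fin (T₀ + 1) × Fin (T₁ + 1)) (Fin (T₀ + 1) × Fin (T₁ + 1)) ℤ :=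
    Matrix.of fun i j =>
      if (e i : ℕ) + 1 < (T₀ + 1) * (T₁ + 1) then taylorInt (e i) (monoXY j.1 j.2) else 0
  have hrow : ∀ j, B (e.symm ⟨(T₀ + 1) * (T₁ + 1) - 1, Nat.sub_lt hMpos one_pos⟩) j = 0 := by
    intro j
    simp only [B, Matrix.of_apply, Equiv.apply_symm_apply]
    rw [if_neg (by omega)]
  have hdet : B.det = 0 := Matrix.det_eq_zero_of_row_eq_zero _ hrow
  obtain ⟨v, hv, hBv⟩ := Matrix.exists_mulVec_eq_zero_iff.mpr hdet
  refine ⟨polyOfCoeffs v, polyOfCoeffs_ne_zero hv, degreeOf_polyOfCoeffs_fst v,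
    degreeOf_polyOfCoeffs_snd v, fun n hn => ?_⟩
  have h := congr_fun hBv (e.symm ⟨n, by omega⟩)
  simp only [B, Matrix.mulVec, dotProduct, Matrix.of_apply, Equiv.apply_symm_apply,
    Pi.zero_apply, if_pos hn] at h
  rw [taylorInt_polyOfCoeffs]
  exact h

/-- **Perfectness of `(1, e^w, …, e^{T₁ w})` at equal weights `T₀`, integer version.** The
maximal contact at `w = 0` of `P(w, e^w)`, `P ∈ ℤ[X₀,X₁] \ {0}` of bidegree `≤ (T₀, T₁)`, is
EXACTLY `(T₀+1)(T₁+1) - 1`: no form reaches `(T₀+1)(T₁+1)`, and some form reaches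
`(T₀+1)(T₁+1) - 1`. [folklore] -/
theorem hermite_perfect (T₀ T₁ : ℕ) :
    (∀ P : MvPolynomial (Fin 2) ℤ, P ≠ 0 → P.degreeOf 0 ≤ T₀ → P.degreeOf 1 ≤ T₁ →
        ∃ n < (T₀ + 1) * (T₁ + 1), taylorInt n P ≠ 0) ∧
      ∃ P : MvPolynomial (Fin 2) ℤ, P ≠ 0 ∧ P.degreeOf 0 ≤ T₀ ∧ P.degreeOf 1 ≤ T₁ ∧
        ∀ n, n + 1 < (T₀ + 1) * (T₁ + 1) → taylorInt n P = 0 :=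
  ⟨fun P hP h0 h1 => exists_taylorInt_ne_zero P hP h0 h1, exists_maximal_contact T₀ T₁⟩

end Summit.Schanuel.Schanuel.Theorems
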